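import Mathlib
import HarnessLib
import Summits.CriticalPhenomena.PercolationContinuityZ3.Theorems.PercNearOneGluingNoHeavyLowerTailTwoCopyLadderAllGradesRung

/-!
# LEMMA Q — the symmetric double of every ladder side is nonnegative for `q ∈ [0,1]` (part 1 of 10)

Helper files for crux `stmt-CriticalPhenomena-4575` (new-inequality factory `prim-ineq-gen-1`, gen 20); memo
`run/shared/lean/prim/prim-ineq-gen-1/FINDING-28-lemma-Q-tower.md`.  Sequel to `…TwoCopyLadderAllGradesRung` (gen 19), which reduced the
real-`q` rung theorem for ALL ladders (`Bhat q X Y ≥ 0`: Rayleigh negative correlation of the apex edge `av` of `L_r + av` with every rung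
at every `0 < q < 1`) to LEMMA Q: `Qsym q X = Bhat q X X ≥ 0` on the orbit `Orb` of the q-moves (`rungStep`,
    `qpendU`, `qpendW`, `mergeUW`
from `triv`).  METHOD ("self-generated tower"): expanding `Qsym q (move_ρ X)` in powers of the new weight `ρ` produces quartic forms in
the five types; iterating,
    the LP closure over `q ∈ [0,1]` (multipliers and remainders in the Bernstein-type basis `qⁱ(1−q)ʲ`) terminates
with the 12 forms `Qsym, QU3, QU2, QU1, QU3W3, QU3S3, QU1S1` and the mirrors (`mir`,
    `u ↔ w`) of the five non-symmetric ones: every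
`ρ`-coefficient of every form under every move is a nonnegative combination of the 12 forms plus a polynomial that is manifestly
nonnegative for `0 ≤ q ≤ 1` and nonnegative entries (71 exact LP certificates, kit jobs j133358
    + j133934; every identity below is checked by
`ring`).  Hence all 12 forms are nonnegative along the orbit by one simultaneous induction (`goodL_of_orb`,
    last part) — LEMMA Q
(`Qsym_nonneg_of_orb`) — and, with `rung_allq_nonneg_of_Qsym` of gen 19,
    the unconditional real-`q` rung theorem `rung_allq_nonneg`.
NOT formalised: the identification of `Bhat`/`Orb` with the graph polynomials (memo FINDING-26 §1).  (This work,
    2026-08-21.)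
-/

namespace Summit.CriticalPhenomena.PercolationContinuityZ3.Theorems

namespace TwoCopyLadderAllGrades

open TwoCopyLadderCubic

variable {R : Type*} [CommRing R]

omit [CommRing R] in
/-- The mirror `u ↔ w` of an S-vector (`p ↔ m`). [this work] -/
def mir (X : SVec R) : SVec R := { c := X.c, p := X.m, m := X.p, d := X.d, s := X.s }

omit [CommRing R] in
/-- `mir` is an involution. [this work] -/
theorem mir_mir (X : SVec R) : mir (mir X) = X := by
  cases X; rfl

/-- A q-pendant edge at `w` is the mirror of a q-pendant edge at `u` of the mirror. [this work] -/
theorem qpendW_eq_mir (q ρ : R) (X : SVec R) : qpendW q ρ X = mir (qpendU q ρ (mir X)) := by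
  cases X; rfl

/-- The mirror of a q-pendant edge at `u` is a q-pendant edge at `w` of the mirror. [this work] -/
theorem mir_qpendU (q ρ : R) (X : SVec R) : mir (qpendU q ρ X) = qpendW q ρ (mir X) := by
  cases X; rfl

/-- `Qsym` is mirror-symmetric. [this work] -/
theorem Qsym_mir (q : R) (X : SVec R) : Qsym q (mir X) = Qsym q X := by
  simp only [Qsym, Bhat, Aq, Atq, mir]
  ring

/-- `Aq` of the mirror under a terminal rung. [this work] -/
theorem Aq_mir_rungStep (q t : R) (X : SVec R) : Aq q (mir (rungStep t X)) = (t + 1) * Aq q (mir X) := by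
  simp only [Aq, mir, rungStep]
  ring

/-- `Dl` of the mirror under a terminal rung. [this work] -/
theorem Dl_mir_rungStep (t : R) (X : SVec R) : Dl (mir (rungStep t X)) = (t + 1) * Dl (mir X) + t * X.m * X.s := by
  simp only [Dl, mir, rungStep]
  ring

/-- `Aq` of the mirror vanishes after merging. [this work] -/
theorem Aq_mir_mergeUW (q : R) (X : SVec R) : Aq q (mir (mergeUW X)) = 0 := by
  simp only [Aq, mir, mergeUW]
  ring

/-- `Dl` of the mirror vanishes after merging. [this work] -/
theorem Dl_mir_mergeUW (X : SVec R) : Dl (mir (mergeUW X)) = 0 := by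
  simp only [Dl, mir, mergeUW]
  ring

/-- `Qsym` vanishes after merging (`Bhat_mergeUW`). [this work] -/
theorem Qsym_mergeUW_zero (q : R) (X : SVec R) : Qsym q (mergeUW X) = 0 := by
  unfold Qsym; exact Bhat_mergeUW q X (mergeUW X)

/-- Tower form `QU3` — monomial chunk 1/2. [this work] -/
@[irreducible] def QU3_c0 (q : R) (X : SVec R) : R :=
  -6 * q ^ 3 * X.m ^ 2 * X.d * X.s - 2 * q ^ 3 * X.m ^ 2 * X.d ^ 2 + 6 * q ^ 3 * X.p * X.m * X.s ^ 2
    - 2 * q ^ 3 * X.p ^ 2 * X.d * X.s + 6 * q ^ 3 * X.c * X.m * X.s ^ 2 + 4 * q ^ 3 * X.c * X.p * X.s ^ 2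
    + 2 * q ^ 3 * X.c ^ 2 * X.s ^ 2 + 6 * q ^ 2 * X.m ^ 2 * X.d * X.s - 6 * q ^ 2 * X.m ^ 3 * X.d
    + 12 * q ^ 2 * X.p * X.m * X.d * X.s + 2 * q ^ 2 * X.p * X.m * X.d ^ 2 + 12 * q ^ 2 * X.p * X.m ^ 2 * X.s
    - 6 * q ^ 2 * X.p * X.m ^ 2 * X.d + 2 * q ^ 2 * X.p ^ 2 * X.d * X.s - 2 * q ^ 2 * X.p ^ 2 * X.d ^ 2
    + 12 * q ^ 2 * X.p ^ 2 * X.m * X.s - 2 * q ^ 2 * X.p ^ 2 * X.m * X.d - 2 * q ^ 2 * X.p ^ 3 * X.d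
    - 6 * q ^ 2 * X.c * X.m * X.s ^ 2 - 2 * q ^ 2 * X.c * X.m * X.d ^ 2 + 6 * q ^ 2 * X.c * X.m ^ 2 * X.s
    - 4 * q ^ 2 * X.c * X.m ^ 2 * X.d - 2 * q ^ 2 * X.c * X.p * X.s ^ 2 + 4 * q ^ 2 * X.c * X.p * X.d * X.s
    + 20 * q ^ 2 * X.c * X.p * X.m * X.s + 6 * q ^ 2 * X.c * X.p ^ 2 * X.s + 2 * q ^ 2 * X.c ^ 2 * X.d * X.s
    + 4 * q ^ 2 * X.c ^ 2 * X.m * X.s + 4 * q ^ 2 * X.c ^ 2 * X.p * X.s + 2 * q * X.m ^ 2 * X.d ^ 2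
    + 6 * q * X.m ^ 3 * X.d + 4 * q * X.p * X.m * X.d ^ 2 + 18 * q * X.p * X.m ^ 2 * X.d + 6 * q * X.p * X.m ^ 3
    + 2 * q * X.p ^ 2 * X.d ^ 2 + 14 * q * X.p ^ 2 * X.m * X.d + 12 * q * X.p ^ 2 * X.m ^ 2 + 2 * q * X.p ^ 3 * X.d
    + 6 * q * X.p ^ 3 * X.m + 2 * q * X.c * X.m * X.d ^ 2

/-- Tower form `QU3` — monomial chunk 2/2. [this work] -/
@[irreducible] def QU3_c1 (q : R) (X : SVec R) : R :=
  -6 * q * X.c * X.m ^ 2 * X.s + 2 * q * X.c * X.p * X.d ^ 2 - 4 * q * X.c * X.p * X.m * X.s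
    + 8 * q * X.c * X.p * X.m * X.d + 10 * q * X.c * X.p * X.m ^ 2 - 2 * q * X.c * X.p ^ 2 * X.s
    + 12 * q * X.c * X.p ^ 2 * X.m + 2 * q * X.c * X.p ^ 3 - 2 * q * X.c ^ 2 * X.s ^ 2 - 2 * q * X.c ^ 2 * X.d * X.s
    - 2 * q * X.c ^ 2 * X.m * X.d + 4 * q * X.c ^ 2 * X.p * X.s + 2 * q * X.c ^ 2 * X.p * X.d
    + 4 * q * X.c ^ 2 * X.p * X.m + 2 * q * X.c ^ 2 * X.p ^ 2 + 2 * q * X.c ^ 3 * X.s + 4 * X.c * X.m ^ 2 * X.d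
    + 8 * X.c * X.p * X.m * X.d + 4 * X.c * X.p * X.m ^ 2 + 4 * X.c * X.p ^ 2 * X.d + 4 * X.c * X.p ^ 2 * X.m
    - 4 * X.c ^ 2 * X.m * X.s + 2 * X.c ^ 2 * X.m * X.d - 4 * X.c ^ 2 * X.p * X.s + 2 * X.c ^ 2 * X.p * X.d
    + 6 * X.c ^ 2 * X.p * X.m + 2 * X.c ^ 2 * X.p ^ 2 - 2 * X.c ^ 3 * X.s + 2 * X.c ^ 3 * X.p

/-- Tower form `QU3` (69 monomials): the iterated weight-coefficient `U3` of the symmetric double `Qsym`. [this work] -/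
@[irreducible] def QU3 (q : R) (X : SVec R) : R :=
  QU3_c0 q X + QU3_c1 q X

/-- Tower form `QU2` — monomial chunk 1/2. [this work] -/
@[irreducible] def QU2_c0 (q : R) (X : SVec R) : R :=
  -6 * q ^ 4 * X.m ^ 2 * X.d * X.s - q ^ 4 * X.m ^ 2 * X.d ^ 2 + 6 * q ^ 4 * X.p * X.m * X.s ^ 2
    + 6 * q ^ 4 * X.c * X.m * X.s ^ 2 + 2 * q ^ 4 * X.c * X.p * X.s ^ 2 + q ^ 4 * X.c ^ 2 * X.s ^ 2
    + 6 * q ^ 3 * X.m ^ 2 * X.d * X.s - 3 * q ^ 3 * X.m ^ 2 * X.d ^ 2 - 6 * q ^ 3 * X.m ^ 3 * X.d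
    + 12 * q ^ 3 * X.p * X.m * X.d * X.s + 12 * q ^ 3 * X.p * X.m ^ 2 * X.s - 6 * q ^ 3 * X.p * X.m ^ 2 * X.d
    + 12 * q ^ 3 * X.p ^ 2 * X.m * X.s - 6 * q ^ 3 * X.c * X.m * X.s ^ 2 - 2 * q ^ 3 * X.c * X.m * X.d ^ 2
    + 6 * q ^ 3 * X.c * X.m ^ 2 * X.s - 2 * q ^ 3 * X.c * X.m ^ 2 * X.d + 2 * q ^ 3 * X.c * X.p * X.s ^ 2
    + 4 * q ^ 3 * X.c * X.p * X.d * X.s + 16 * q ^ 3 * X.c * X.p * X.m * X.s + 4 * q ^ 3 * X.c * X.p ^ 2 * X.s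
    + 3 * q ^ 3 * X.c ^ 2 * X.s ^ 2 + 2 * q ^ 3 * X.c ^ 2 * X.d * X.s + 2 * q ^ 3 * X.c ^ 2 * X.m * X.s
    + 2 * q ^ 3 * X.c ^ 2 * X.p * X.s + 4 * q ^ 2 * X.m ^ 2 * X.d ^ 2 + 6 * q ^ 2 * X.m ^ 3 * X.d
    + 6 * q ^ 2 * X.p * X.m * X.d ^ 2 + 18 * q ^ 2 * X.p * X.m ^ 2 * X.d + 6 * q ^ 2 * X.p * X.m ^ 3
    + 12 * q ^ 2 * X.p ^ 2 * X.m * X.d + 12 * q ^ 2 * X.p ^ 2 * X.m ^ 2 + 6 * q ^ 2 * X.p ^ 3 * X.m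
    - 6 * q ^ 2 * X.c * X.m ^ 2 * X.s - 6 * q ^ 2 * X.c * X.m ^ 2 * X.d + 4 * q ^ 2 * X.c * X.p * X.d * X.s
    + 2 * q ^ 2 * X.c * X.p * X.d ^ 2 + 4 * q ^ 2 * X.c * X.p * X.m * X.s + 4 * q ^ 2 * X.c * X.p * X.m * X.d
    + 8 * q ^ 2 * X.c * X.p * X.m ^ 2

/-- Tower form `QU2` — monomial chunk 2/2. [this work] -/
@[irreducible] def QU2_c1 (q : R) (X : SVec R) : R :=
  4 * q ^ 2 * X.c * X.p ^ 2 * X.s + 4 * q ^ 2 * X.c * X.p ^ 2 * X.d + 10 * q ^ 2 * X.c * X.p ^ 2 * X.m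
    + 2 * q ^ 2 * X.c * X.p ^ 3 - 4 * q ^ 2 * X.c ^ 2 * X.s ^ 2 + 6 * q ^ 2 * X.c ^ 2 * X.m * X.s
    - 2 * q ^ 2 * X.c ^ 2 * X.m * X.d + 10 * q ^ 2 * X.c ^ 2 * X.p * X.s + 2 * q ^ 2 * X.c ^ 2 * X.p * X.d
    + 2 * q ^ 2 * X.c ^ 2 * X.p * X.m + q ^ 2 * X.c ^ 2 * X.p ^ 2 + 2 * q ^ 2 * X.c ^ 3 * X.s
    + 2 * q * X.c * X.m * X.d ^ 2 + 8 * q * X.c * X.m ^ 2 * X.d + 2 * q * X.c * X.p * X.d ^ 2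
    + 16 * q * X.c * X.p * X.m * X.d + 8 * q * X.c * X.p * X.m ^ 2 + 4 * q * X.c * X.p ^ 2 * X.d
    + 10 * q * X.c * X.p ^ 2 * X.m + 2 * q * X.c * X.p ^ 3 - 2 * q * X.c ^ 2 * X.d * X.s
    - 8 * q * X.c ^ 2 * X.m * X.s - 4 * q * X.c ^ 2 * X.p * X.s + 4 * q * X.c ^ 2 * X.p * X.d
    + 10 * q * X.c ^ 2 * X.p * X.m + 7 * q * X.c ^ 2 * X.p ^ 2 + 2 * q * X.c ^ 3 * X.p + 2 * X.c ^ 2 * X.m * X.d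
    + 2 * X.c ^ 2 * X.p * X.d + 2 * X.c ^ 2 * X.p * X.m - 2 * X.c ^ 3 * X.s + 2 * X.c ^ 3 * X.p

/-- Tower form `QU2` (72 monomials): the iterated weight-coefficient `U2` of the symmetric double `Qsym`. [this work] -/
@[irreducible] def QU2 (q : R) (X : SVec R) : R :=
  QU2_c0 q X + QU2_c1 q X

/-- Tower form `QU1` — monomial chunk 1/2. [this work] -/
@[irreducible] def QU1_c0 (q : R) (X : SVec R) : R :=
  -2 * q ^ 5 * X.m ^ 2 * X.d * X.s + 2 * q ^ 5 * X.p * X.m * X.s ^ 2 + 2 * q ^ 5 * X.c * X.m * X.s ^ 2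
    + 2 * q ^ 4 * X.m ^ 2 * X.d * X.s - 2 * q ^ 4 * X.m ^ 2 * X.d ^ 2 - 2 * q ^ 4 * X.m ^ 3 * X.d
    + 4 * q ^ 4 * X.p * X.m * X.d * X.s + 4 * q ^ 4 * X.p * X.m ^ 2 * X.s - 2 * q ^ 4 * X.p * X.m ^ 2 * X.d
    + 4 * q ^ 4 * X.p ^ 2 * X.m * X.s - 2 * q ^ 4 * X.c * X.m * X.s ^ 2 + 2 * q ^ 4 * X.c * X.m ^ 2 * X.s
    + 2 * q ^ 4 * X.c * X.p * X.s ^ 2 + 4 * q ^ 4 * X.c * X.p * X.m * X.s + 2 * q ^ 4 * X.c ^ 2 * X.s ^ 2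
    + 2 * q ^ 3 * X.m ^ 2 * X.d ^ 2 + 2 * q ^ 3 * X.m ^ 3 * X.d + 2 * q ^ 3 * X.p * X.m * X.d ^ 2
    + 6 * q ^ 3 * X.p * X.m ^ 2 * X.d + 2 * q ^ 3 * X.p * X.m ^ 3 + 4 * q ^ 3 * X.p ^ 2 * X.m * X.d
    + 4 * q ^ 3 * X.p ^ 2 * X.m ^ 2 + 2 * q ^ 3 * X.p ^ 3 * X.m - 2 * q ^ 3 * X.c * X.m * X.d ^ 2
    - 2 * q ^ 3 * X.c * X.m ^ 2 * X.s - 4 * q ^ 3 * X.c * X.m ^ 2 * X.d + 4 * q ^ 3 * X.c * X.p * X.d * X.s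
    + 4 * q ^ 3 * X.c * X.p * X.m * X.s + 2 * q ^ 3 * X.c * X.p * X.m ^ 2 + 4 * q ^ 3 * X.c * X.p ^ 2 * X.s
    + 2 * q ^ 3 * X.c * X.p ^ 2 * X.m - 2 * q ^ 3 * X.c ^ 2 * X.s ^ 2 + 2 * q ^ 3 * X.c ^ 2 * X.d * X.s
    + 4 * q ^ 3 * X.c ^ 2 * X.m * X.s + 4 * q ^ 3 * X.c ^ 2 * X.p * X.s + 2 * q ^ 2 * X.c * X.m * X.d ^ 2
    + 4 * q ^ 2 * X.c * X.m ^ 2 * X.d + 2 * q ^ 2 * X.c * X.p * X.d ^ 2 + 8 * q ^ 2 * X.c * X.p * X.m * X.d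
    + 4 * q ^ 2 * X.c * X.p * X.m ^ 2

/-- Tower form `QU1` — monomial chunk 2/2. [this work] -/
@[irreducible] def QU1_c1 (q : R) (X : SVec R) : R :=
  4 * q ^ 2 * X.c * X.p ^ 2 * X.d + 6 * q ^ 2 * X.c * X.p ^ 2 * X.m + 2 * q ^ 2 * X.c * X.p ^ 3
    - 2 * q ^ 2 * X.c ^ 2 * X.d * X.s - 4 * q ^ 2 * X.c ^ 2 * X.m * X.s - 2 * q ^ 2 * X.c ^ 2 * X.m * X.d
    + 2 * q ^ 2 * X.c ^ 2 * X.p * X.d + 4 * q ^ 2 * X.c ^ 2 * X.p * X.m + 2 * q ^ 2 * X.c ^ 2 * X.p ^ 2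
    + 2 * q ^ 2 * X.c ^ 3 * X.s + 2 * q * X.c ^ 2 * X.m * X.d + 2 * q * X.c ^ 2 * X.p * X.d
    + 2 * q * X.c ^ 2 * X.p * X.m + 2 * q * X.c ^ 2 * X.p ^ 2 - 2 * q * X.c ^ 3 * X.s + 2 * q * X.c ^ 3 * X.p

/-- Tower form `QU1` (56 monomials): the iterated weight-coefficient `U1` of the symmetric double `Qsym`. [this work] -/
@[irreducible] def QU1 (q : R) (X : SVec R) : R :=
  QU1_c0 q X + QU1_c1 q X

/-- Tower form `QU3W3` — monomial chunk 1/3. [this work] -/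
@[irreducible] def QU3W3_c0 (q : R) (X : SVec R) : R :=
  -6 * q ^ 4 * X.m ^ 2 * X.d * X.s + 18 * q ^ 4 * X.p * X.m * X.s ^ 2 - 6 * q ^ 4 * X.p ^ 2 * X.d * X.s
    + 12 * q ^ 4 * X.c * X.m * X.s ^ 2 + 12 * q ^ 4 * X.c * X.p * X.s ^ 2 + 4 * q ^ 4 * X.c ^ 2 * X.s ^ 2
    + 6 * q ^ 3 * X.m ^ 2 * X.d * X.s - 6 * q ^ 3 * X.m ^ 2 * X.d ^ 2 - 6 * q ^ 3 * X.m ^ 3 * X.d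
    + 36 * q ^ 3 * X.p * X.m * X.d * X.s + 2 * q ^ 3 * X.p * X.m * X.d ^ 2 + 36 * q ^ 3 * X.p * X.m ^ 2 * X.s
    - 6 * q ^ 3 * X.p * X.m ^ 2 * X.d + 6 * q ^ 3 * X.p ^ 2 * X.d * X.s - 6 * q ^ 3 * X.p ^ 2 * X.d ^ 2
    + 36 * q ^ 3 * X.p ^ 2 * X.m * X.s - 6 * q ^ 3 * X.p ^ 2 * X.m * X.d - 6 * q ^ 3 * X.p ^ 3 * X.d
    - 6 * q ^ 3 * X.c * X.m * X.s ^ 2 + 12 * q ^ 3 * X.c * X.m * X.d * X.s + 18 * q ^ 3 * X.c * X.m ^ 2 * X.s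
    - 6 * q ^ 3 * X.c * X.p * X.s ^ 2 + 12 * q ^ 3 * X.c * X.p * X.d * X.s + 48 * q ^ 3 * X.c * X.p * X.m * X.s
    + 18 * q ^ 3 * X.c * X.p ^ 2 * X.s + 4 * q ^ 3 * X.c ^ 2 * X.s ^ 2 + 6 * q ^ 3 * X.c ^ 2 * X.d * X.s
    + 8 * q ^ 3 * X.c ^ 2 * X.m * X.s + 8 * q ^ 3 * X.c ^ 2 * X.p * X.s + 6 * q ^ 2 * X.m ^ 2 * X.d ^ 2
    + 6 * q ^ 2 * X.m ^ 3 * X.d + 16 * q ^ 2 * X.p * X.m * X.d ^ 2 + 42 * q ^ 2 * X.p * X.m ^ 2 * X.d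
    + 18 * q ^ 2 * X.p * X.m ^ 3 + 6 * q ^ 2 * X.p ^ 2 * X.d ^ 2 + 42 * q ^ 2 * X.p ^ 2 * X.m * X.d
    + 36 * q ^ 2 * X.p ^ 2 * X.m ^ 2 + 6 * q ^ 2 * X.p ^ 3 * X.d + 18 * q ^ 2 * X.p ^ 3 * X.m
    + 2 * q ^ 2 * X.c * X.m * X.d ^ 2

/-- Tower form `QU3W3` — monomial chunk 2/3. [this work] -/
@[irreducible] def QU3W3_c1 (q : R) (X : SVec R) : R :=
  -6 * q ^ 2 * X.c * X.m ^ 2 * X.s + 6 * q ^ 2 * X.c * X.m ^ 3 + 2 * q ^ 2 * X.c * X.p * X.d ^ 2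
    + 12 * q ^ 2 * X.c * X.p * X.m * X.s + 28 * q ^ 2 * X.c * X.p * X.m * X.d + 30 * q ^ 2 * X.c * X.p * X.m ^ 2
    - 6 * q ^ 2 * X.c * X.p ^ 2 * X.s + 30 * q ^ 2 * X.c * X.p ^ 2 * X.m + 6 * q ^ 2 * X.c * X.p ^ 3
    - 6 * q ^ 2 * X.c ^ 2 * X.s ^ 2 + 2 * q ^ 2 * X.c ^ 2 * X.d * X.s + 2 * q ^ 2 * X.c ^ 2 * X.d ^ 2
    + 20 * q ^ 2 * X.c ^ 2 * X.m * X.s + 6 * q ^ 2 * X.c ^ 2 * X.m * X.d + 4 * q ^ 2 * X.c ^ 2 * X.m ^ 2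
    + 20 * q ^ 2 * X.c ^ 2 * X.p * X.s + 6 * q ^ 2 * X.c ^ 2 * X.p * X.d + 8 * q ^ 2 * X.c ^ 2 * X.p * X.m
    + 4 * q ^ 2 * X.c ^ 2 * X.p ^ 2 + 6 * q ^ 2 * X.c ^ 3 * X.s + 4 * q * X.c * X.m * X.d ^ 2
    + 12 * q * X.c * X.m ^ 2 * X.d + 4 * q * X.c * X.p * X.d ^ 2 + 32 * q * X.c * X.p * X.m * X.d
    + 24 * q * X.c * X.p * X.m ^ 2 + 12 * q * X.c * X.p ^ 2 * X.d + 24 * q * X.c * X.p ^ 2 * X.m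
    - 4 * q * X.c ^ 2 * X.d * X.s - 12 * q * X.c ^ 2 * X.m * X.s + 6 * q * X.c ^ 2 * X.m * X.d
    + 10 * q * X.c ^ 2 * X.m ^ 2 - 12 * q * X.c ^ 2 * X.p * X.s + 6 * q * X.c ^ 2 * X.p * X.d
    + 34 * q * X.c ^ 2 * X.p * X.m + 10 * q * X.c ^ 2 * X.p ^ 2 + 2 * q * X.c ^ 3 * X.s + 4 * q * X.c ^ 3 * X.d
    + 6 * q * X.c ^ 3 * X.m + 6 * q * X.c ^ 3 * X.p + 4 * X.c ^ 2 * X.m * X.d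

/-- Tower form `QU3W3` — monomial chunk 3/3. [this work] -/
@[irreducible] def QU3W3_c2 (_q : R) (X : SVec R) : R :=
  4 * X.c ^ 2 * X.p * X.d + 4 * X.c ^ 2 * X.p * X.m - 4 * X.c ^ 3 * X.s + 4 * X.c ^ 3 * X.m + 4 * X.c ^ 3 * X.p
    + 2 * X.c ^ 4

/-- Tower form `QU3W3` (86 monomials): the iterated weight-coefficient `U3.W3` of the symmetric double `Qsym`. [this work] -/
@[irreducible] def QU3W3 (q : R) (X : SVec R) : R :=
  QU3W3_c0 q X + QU3W3_c1 q X + QU3W3_c2 q X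

/-- Tower form `QU3S3` — monomial chunk 1/2. [this work] -/
@[irreducible] def QU3S3_c0 (q : R) (X : SVec R) : R :=
  -2 * q ^ 2 * X.m ^ 2 * X.d * X.s - 2 * q ^ 2 * X.m ^ 2 * X.d ^ 2 + 2 * q ^ 2 * X.p * X.m * X.s ^ 2
    - 2 * q ^ 2 * X.p * X.m * X.d ^ 2 + 2 * q ^ 2 * X.p ^ 2 * X.s ^ 2 + 2 * q ^ 2 * X.p ^ 2 * X.d * X.s
    + 2 * q ^ 2 * X.c * X.m * X.s ^ 2 - 2 * q ^ 2 * X.c * X.m * X.d ^ 2 + 4 * q ^ 2 * X.c * X.p * X.s ^ 2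
    + 4 * q ^ 2 * X.c * X.p * X.d * X.s + 2 * q ^ 2 * X.c ^ 2 * X.s ^ 2 + 2 * q ^ 2 * X.c ^ 2 * X.d * X.s
    + 2 * q * X.m ^ 2 * X.d * X.s + 2 * q * X.m ^ 2 * X.d ^ 2 - 2 * q * X.m ^ 3 * X.d
    + 4 * q * X.p * X.m * X.d * X.s + 4 * q * X.p * X.m * X.d ^ 2 + 4 * q * X.p * X.m ^ 2 * X.s
    - 2 * q * X.p * X.m ^ 2 * X.d + 2 * q * X.p ^ 2 * X.d * X.s + 2 * q * X.p ^ 2 * X.d ^ 2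
    + 8 * q * X.p ^ 2 * X.m * X.s + 2 * q * X.p ^ 2 * X.m * X.d + 4 * q * X.p ^ 3 * X.s + 2 * q * X.p ^ 3 * X.d
    - 2 * q * X.c * X.m * X.s ^ 2 + 2 * q * X.c * X.m * X.d ^ 2 + 2 * q * X.c * X.m ^ 2 * X.s
    - 4 * q * X.c * X.m ^ 2 * X.d - 2 * q * X.c * X.p * X.s ^ 2 + 2 * q * X.c * X.p * X.d ^ 2
    + 12 * q * X.c * X.p * X.m * X.s + 10 * q * X.c * X.p ^ 2 * X.s + 4 * q * X.c * X.p ^ 2 * X.d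
    - 2 * q * X.c ^ 2 * X.s ^ 2 - 2 * q * X.c ^ 2 * X.d * X.s + 4 * q * X.c ^ 2 * X.m * X.s
    - 2 * q * X.c ^ 2 * X.m * X.d + 8 * q * X.c ^ 2 * X.p * X.s + 2 * q * X.c ^ 2 * X.p * X.d

/-- Tower form `QU3S3` — monomial chunk 2/2. [this work] -/
@[irreducible] def QU3S3_c1 (q : R) (X : SVec R) : R :=
  2 * q * X.c ^ 3 * X.s + 2 * X.m ^ 3 * X.d + 6 * X.p * X.m ^ 2 * X.d + 2 * X.p * X.m ^ 3 + 6 * X.p ^ 2 * X.m * X.d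
    + 6 * X.p ^ 2 * X.m ^ 2 + 2 * X.p ^ 3 * X.d + 6 * X.p ^ 3 * X.m + 2 * X.p ^ 4 - 2 * X.c * X.m ^ 2 * X.s
    + 4 * X.c * X.m ^ 2 * X.d - 4 * X.c * X.p * X.m * X.s + 8 * X.c * X.p * X.m * X.d + 6 * X.c * X.p * X.m ^ 2
    - 2 * X.c * X.p ^ 2 * X.s + 4 * X.c * X.p ^ 2 * X.d + 12 * X.c * X.p ^ 2 * X.m + 6 * X.c * X.p ^ 3
    - 4 * X.c ^ 2 * X.m * X.s + 2 * X.c ^ 2 * X.m * X.d - 4 * X.c ^ 2 * X.p * X.s + 2 * X.c ^ 2 * X.p * X.d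
    + 6 * X.c ^ 2 * X.p * X.m + 6 * X.c ^ 2 * X.p ^ 2 - 2 * X.c ^ 3 * X.s + 2 * X.c ^ 3 * X.p

/-- Tower form `QU3S3` (66 monomials): the iterated weight-coefficient `U3.S3` of the symmetric double `Qsym`. [this work] -/
@[irreducible] def QU3S3 (q : R) (X : SVec R) : R :=
  QU3S3_c0 q X + QU3S3_c1 q X

/-- Tower form `QU1S1` — monomial chunk 1/3. [this work] -/
@[irreducible] def QU1S1_c0 (q : R) (X : SVec R) : R :=
  -2 * q ^ 5 * X.m ^ 2 * X.d * X.s + 2 * q ^ 5 * X.p * X.m * X.s ^ 2 + 2 * q ^ 5 * X.c * X.m * X.s ^ 2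
    - 2 * q ^ 4 * X.m ^ 2 * X.d * X.s - 4 * q ^ 4 * X.m ^ 2 * X.d ^ 2 - 2 * q ^ 4 * X.m ^ 3 * X.d
    + 4 * q ^ 4 * X.p * X.m * X.s ^ 2 + 4 * q ^ 4 * X.p * X.m * X.d * X.s + 4 * q ^ 4 * X.p * X.m ^ 2 * X.s
    - 2 * q ^ 4 * X.p * X.m ^ 2 * X.d + 2 * q ^ 4 * X.p ^ 2 * X.s ^ 2 + 4 * q ^ 4 * X.p ^ 2 * X.m * X.s
    + 2 * q ^ 4 * X.c * X.m * X.s ^ 2 + 2 * q ^ 4 * X.c * X.m ^ 2 * X.s + 6 * q ^ 4 * X.c * X.p * X.s ^ 2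
    + 4 * q ^ 4 * X.c * X.p * X.m * X.s + 4 * q ^ 4 * X.c ^ 2 * X.s ^ 2 + 4 * q ^ 3 * X.m ^ 2 * X.d * X.s
    + 2 * q ^ 3 * X.m ^ 2 * X.d ^ 2 - 2 * q ^ 3 * X.m ^ 3 * X.d + 8 * q ^ 3 * X.p * X.m * X.d * X.s
    + 2 * q ^ 3 * X.p * X.m * X.d ^ 2 + 8 * q ^ 3 * X.p * X.m ^ 2 * X.s + 2 * q ^ 3 * X.p * X.m ^ 2 * X.d
    + 2 * q ^ 3 * X.p * X.m ^ 3 + 4 * q ^ 3 * X.p ^ 2 * X.d * X.s + 12 * q ^ 3 * X.p ^ 2 * X.m * X.s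
    + 4 * q ^ 3 * X.p ^ 2 * X.m * X.d + 4 * q ^ 3 * X.p ^ 2 * X.m ^ 2 + 4 * q ^ 3 * X.p ^ 3 * X.s
    + 2 * q ^ 3 * X.p ^ 3 * X.m - 4 * q ^ 3 * X.c * X.m * X.s ^ 2 - 6 * q ^ 3 * X.c * X.m * X.d ^ 2
    + 2 * q ^ 3 * X.c * X.m ^ 2 * X.s - 8 * q ^ 3 * X.c * X.m ^ 2 * X.d + 12 * q ^ 3 * X.c * X.p * X.d * X.s
    + 20 * q ^ 3 * X.c * X.p * X.m * X.s + 2 * q ^ 3 * X.c * X.p * X.m ^ 2 + 12 * q ^ 3 * X.c * X.p ^ 2 * X.s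
    + 2 * q ^ 3 * X.c * X.p ^ 2 * X.m

/-- Tower form `QU1S1` — monomial chunk 2/3. [this work] -/
@[irreducible] def QU1S1_c1 (q : R) (X : SVec R) : R :=
  -2 * q ^ 3 * X.c ^ 2 * X.s ^ 2 + 6 * q ^ 3 * X.c ^ 2 * X.d * X.s + 8 * q ^ 3 * X.c ^ 2 * X.m * X.s
    + 8 * q ^ 3 * X.c ^ 2 * X.p * X.s + 2 * q ^ 2 * X.m ^ 2 * X.d ^ 2 + 4 * q ^ 2 * X.m ^ 3 * X.d
    + 4 * q ^ 2 * X.p * X.m * X.d ^ 2 + 12 * q ^ 2 * X.p * X.m ^ 2 * X.d + 4 * q ^ 2 * X.p * X.m ^ 3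
    + 2 * q ^ 2 * X.p ^ 2 * X.d ^ 2 + 12 * q ^ 2 * X.p ^ 2 * X.m * X.d + 10 * q ^ 2 * X.p ^ 2 * X.m ^ 2
    + 4 * q ^ 2 * X.p ^ 3 * X.d + 8 * q ^ 2 * X.p ^ 3 * X.m + 2 * q ^ 2 * X.p ^ 4 + 6 * q ^ 2 * X.c * X.m * X.d ^ 2
    - 4 * q ^ 2 * X.c * X.m ^ 2 * X.s + 4 * q ^ 2 * X.c * X.m ^ 2 * X.d + 6 * q ^ 2 * X.c * X.p * X.d ^ 2
    + 16 * q ^ 2 * X.c * X.p * X.m * X.d + 12 * q ^ 2 * X.c * X.p * X.m ^ 2 + 4 * q ^ 2 * X.c * X.p ^ 2 * X.s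
    + 12 * q ^ 2 * X.c * X.p ^ 2 * X.d + 18 * q ^ 2 * X.c * X.p ^ 2 * X.m + 6 * q ^ 2 * X.c * X.p ^ 3
    - 2 * q ^ 2 * X.c ^ 2 * X.s ^ 2 - 6 * q ^ 2 * X.c ^ 2 * X.d * X.s - 4 * q ^ 2 * X.c ^ 2 * X.m * X.s
    - 6 * q ^ 2 * X.c ^ 2 * X.m * X.d + 8 * q ^ 2 * X.c ^ 2 * X.p * X.s + 6 * q ^ 2 * X.c ^ 2 * X.p * X.d
    + 8 * q ^ 2 * X.c ^ 2 * X.p * X.m + 4 * q ^ 2 * X.c ^ 2 * X.p ^ 2 + 6 * q ^ 2 * X.c ^ 3 * X.s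
    + 4 * q * X.c * X.m ^ 2 * X.d + 8 * q * X.c * X.p * X.m * X.d + 4 * q * X.c * X.p * X.m ^ 2
    + 4 * q * X.c * X.p ^ 2 * X.d + 8 * q * X.c * X.p ^ 2 * X.m + 4 * q * X.c * X.p ^ 3

/-- Tower form `QU1S1` — monomial chunk 3/3. [this work] -/
@[irreducible] def QU1S1_c2 (q : R) (X : SVec R) : R :=
  -4 * q * X.c ^ 2 * X.m * X.s + 6 * q * X.c ^ 2 * X.m * X.d - 4 * q * X.c ^ 2 * X.p * X.s
    + 6 * q * X.c ^ 2 * X.p * X.d + 10 * q * X.c ^ 2 * X.p * X.m + 10 * q * X.c ^ 2 * X.p ^ 2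
    - 6 * q * X.c ^ 3 * X.s + 6 * q * X.c ^ 3 * X.p

/-- Tower form `QU1S1` (88 monomials): the iterated weight-coefficient `U1.S1` of the symmetric double `Qsym`. [this work] -/
@[irreducible] def QU1S1 (q : R) (X : SVec R) : R :=
  QU1S1_c0 q X + QU1S1_c1 q X + QU1S1_c2 q X

end TwoCopyLadderAllGrades

end Summit.CriticalPhenomena.PercolationContinuityZ3.Theorems
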